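import Summits.BirchSwinnertonDyer.BirchSwinnertonDyer.Theorems.PrintCf2RamifiedOffTYZEvenSquareFormBlocks
import Summits.BirchSwinnertonDyer.BirchSwinnertonDyer.Theorems.PrintCf2RamifiedOffTYZMoverSquaresSix
import Summits.BirchSwinnertonDyer.BirchSwinnertonDyer.Theorems.PrintCf2RamifiedOffTYZMoverSumBlocksSix
import HarnessLib

/-!
# Crux `PrintCf2.RamifiedOffTYZOfFacts` (stmt-BirchSwinnertonDyer-20509), line `offtyz-v7`, LEAD cycle 14 (cruxlead-20509 g13):
# THE EVEN SQUARE FORM, LEVEL ONE — bookkeeping, the block indicators as forms, and `ι(n) + Σ_{d∈R(n)} |𝓛(n/d)|·ι(d)`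

THEOREMS ONLY (no `def`, no named fact, no `sorry`), `--supports stmt-BirchSwinnertonDyer-20509` (C⁺ = item 23431 even sector; the `s = 1` even
stratum of 23432).  Part of the CLOSED-FORM REDUCTION behind the EVEN Ω-IDENTITY (crux workfiles `Lines/offtyz_v7_EvenOmega.lean`,
`Lines/offtyz_v7_RegimeFreeLaw.md` §5b; definitions `…EvenOmegaDefs`): for `n = 2p₁⋯p_k ≡ 6 (mod 8)` and EVERY automorphism `g` of `ℍ′_n`, the
`τ(1)`-coefficient of `g·g·P(n) − P(n)` in g8's even square formula `SquareSilenceEven.galPt_mul_self_P_eq_add_even` (p703022), read modulo `2`,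
is an explicit `𝔽₂`-form in the bits of `g` indexed on the prime tuple — block laws of `…EvenSquareFormBlocks` (regime-free), cofactor parities as
Monsky determinants, and the recursion indices converted to sub-tuples level by level.  BSD is not proved by any of this; no class is closed here.
* §1 bookkeeping: sub-block divisibility, residues, `2d_S ∈ R(n) ⟺ d_{Sᶜ} ≡ 1 (8) ∧ S ≠ univ`, no `d_S ≡ 5` in `R(n)`;
* §2 `iota_six_eq_form`, `iota_five_eq_form`: `ι(2d_S) = (1 + x_im + x_2 + Σ x)·(κ^S·x)`, `ι(d_T) = (1 + x_im + Σ x)·(ρ^T·x)`;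
* §3 `levelOne_eq_sum_blocks`: level 1 with the top block `= Σ_{S : d_{Sᶜ} ≡ 1 (8)} coblockWeight p S·ι-form(2d_S)`.

References: [cite: TianYuanZhang2017, Thm. 1.1, §3.1 (p0011 L1–L13, L53–L73), Prop. 3.2 (1)(2), Thm. 3.6 (1)(2), proof of Lemma 3.21 (p0020 L27–L63)];
[cite: HeathBrown1994SelmerCongruentII, Appendix (Monsky), typescript p. 39 L10 – p. 41 L36]; [cite: Smith2016CongruentDensity, Thm. 2.2 rows 1–3];
[cite: Cox2013, §5.C Lemma 5.19, §7.D, §9.A].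
-/

noncomputable section

open scoped Classical NumberField

open WeierstrassCurve WeierstrassCurve.Affine Finset Matrix Literature.NumberTheory.EllipticCurves
  Literature.NumberTheory.EllipticCurves.TianYuanZhang2017
  Literature.NumberTheory.EllipticCurves.TianYuanZhang2017.W2
  Literature.NumberTheory.EllipticCurves.HeathBrown1994
  Literature.NumberTheory.EllipticCurves.HeathBrown1994.Families
  Literature.NumberTheory.EllipticCurves.Smith2016
  Literature.NumberTheory.EllipticCurves.MonskySelmerParity
  Literature.NumberTheory.QuadraticFields.RingClass
  Literature.NumberTheory.QuadraticFields
  Literature.LinearAlgebra.Matrix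
  Summit.BirchSwinnertonDyer.Rank1Residual.P2.GenusPeriodTransferLayer
  Summit.BirchSwinnertonDyer.Rank1Residual.P2.ThetaDescent
  Summit.BirchSwinnertonDyer.PrintCf2.QForm

set_option autoImplicit false

namespace Summit.BirchSwinnertonDyer.PrintCf2.MoverAssembly

variable {k : ℕ} (p : Fin k → ℕ) (hp : ∀ i, (p i).Prime) (hodd : ∀ i, Odd (p i)) (hinj : Function.Injective p)

/-! ## §1 Bookkeeping -/

include hp hinj in
/-- `d_T ∣ d_W ⟺ T ⊆ W` (square-free sub-products of distinct primes). [cite: Smith2016CongruentDensity, §2.1 Remark 2.3] -/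
theorem blockProd_dvd_blockProd_iff (T W : Finset (Fin k)) : (∏ i ∈ T, p i) ∣ (∏ i ∈ W, p i) ↔ T ⊆ W := by
  constructor
  · intro h i hi
    exact (prime_dvd_blockProd_iff p hp hinj W i).mp ((dvd_prod_of_mem p hi).trans h)
  · intro h; exact Finset.prod_dvd_prod_of_subset _ _ _ h

include hp hodd in
/-- `2d_T` never divides the odd `d_W`. [folklore] -/
theorem not_two_mul_blockProd_dvd_blockProd (T W : Finset (Fin k)) : ¬ (2 * ∏ i ∈ T, p i) ∣ (∏ i ∈ W, p i) := by
  intro h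
  have h2 : 2 ∣ ∏ i ∈ W, p i := (Dvd.intro _ rfl).trans h
  have hoddW : Odd (∏ i ∈ W, p i) := by
    rw [← prod_blockPrimes p W]; exact odd_prod _ (blockPrimes_prime p hp W) (ne_two_of_odd _ (blockPrimes_odd p hodd W))
  exact (Nat.not_even_iff_odd.mpr hoddW) (even_iff_two_dvd.mpr h2)

include hp hodd hinj in
/-- `d_T ∣ 2d_W ⟺ T ⊆ W`. [folklore] -/
theorem blockProd_dvd_two_mul_blockProd_iff (T W : Finset (Fin k)) : (∏ i ∈ T, p i) ∣ (2 * ∏ i ∈ W, p i) ↔ T ⊆ W := by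
  constructor
  · intro h i hi
    have hpi : p i ∣ 2 * ∏ j ∈ W, p j := (dvd_prod_of_mem p hi).trans h
    rcases (Nat.Prime.dvd_mul (hp i)).mp hpi with h2 | hW
    · exact absurd ((Nat.prime_dvd_prime_iff_eq (hp i) Nat.prime_two).mp h2) (ne_two_of_odd p hodd i)
    · exact (prime_dvd_blockProd_iff p hp hinj W i).mp hW
  · intro h; exact Dvd.dvd.mul_left (Finset.prod_dvd_prod_of_subset _ _ _ h) 2

/-- `2d_T ∣ 2d_W ⟺ d_T ∣ d_W`. [folklore] -/
theorem two_mul_blockProd_dvd_two_mul_iff (T W : Finset (Fin k)) :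
    (2 * ∏ i ∈ T, p i) ∣ (2 * ∏ i ∈ W, p i) ↔ (∏ i ∈ T, p i) ∣ (∏ i ∈ W, p i) :=
  Nat.mul_dvd_mul_iff_left two_pos

/-- Residues: `d_S · d_{Sᶜ} = d`, so `d_{Sᶜ} ≡ 1 (mod 8)` and `d ≡ 3 (mod 4)` force `d_S ≡ 3 (mod 4)`. [folklore] -/
theorem blockProd_mod_four_of_compl_one (h3 : (∏ i, p i) % 4 = 3) (S : Finset (Fin k)) (hS1 : (∏ i ∈ Sᶜ, p i) % 8 = 1) :
    (∏ i ∈ S, p i) % 4 = 3 := by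
  have hsplit : (∏ j ∈ S, p j) * (∏ j ∈ Sᶜ, p j) = ∏ i, p i := Finset.prod_mul_prod_compl S p
  have hmod := Nat.mul_mod (∏ j ∈ S, p j) (∏ j ∈ Sᶜ, p j) 4
  rw [hsplit, h3, show (∏ j ∈ Sᶜ, p j) % 4 = 1 by omega, mul_one, Nat.mod_mod] at hmod
  omega

variable {n : ℕ} (D : GenusPointData n)

include hp hodd in
/-- **Membership of an even block in `R(n)`**: `2d_S ∈ recursionIndex n` iff `d_{Sᶜ} ≡ 1 (mod 8)` and `S ≠ univ` (`n = 2p₁⋯p_k`, `∏pᵢ ≡ 3 (mod 4)`).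
[cite: TianYuanZhang2017, §3.1 (p0011 L67–L73), Thm. 3.6] -/
theorem two_mul_blockProd_mem_recursionIndex_iff (hn : n = 2 * ∏ i, p i) (h3 : (∏ i, p i) % 4 = 3) (S : Finset (Fin k)) :
    2 * ∏ i ∈ S, p i ∈ recursionIndex n ↔ (∏ i ∈ Sᶜ, p i) % 8 = 1 ∧ S ≠ univ := by
  have hp2 : ∀ i, p i ≠ 2 := ne_two_of_odd p hodd
  have hdiv := div_twice_blockProd p hp hn S
  have hmem := twice_blockProd_mem_divisors p hp hn S
  have hcodd : Odd (∏ i ∈ Sᶜ, p i) := by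
    rw [← prod_blockPrimes p Sᶜ]; exact odd_prod _ (blockPrimes_prime p hp Sᶜ) (ne_two_of_odd _ (blockPrimes_odd p hodd Sᶜ))
  rw [mem_recursionIndex_iff, hdiv]
  constructor
  · rintro ⟨-, h567, h123, hgt⟩
    have hS4 : (∏ i ∈ S, p i) % 4 = 3 := by omega
    rcases cofactor_mod_eight_of_three p hp hodd h3 S hS4 with h1 | h5
    · refine ⟨h1, ?_⟩
      rintro rfl
      rw [Finset.compl_univ, prod_empty] at hgt; exact lt_irrefl 1 hgt
    · omega
  · rintro ⟨h1, hSu⟩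
    have hS4 := blockProd_mod_four_of_compl_one p h3 S h1
    refine ⟨hmem, Or.inr (Or.inl (by omega)), Or.inl h1, ?_⟩
    have hne : Sᶜ.Nonempty := by
      rw [Finset.nonempty_iff_ne_empty, Ne, Finset.compl_eq_empty_iff]; exact hSu
    obtain ⟨i, hi⟩ := hne
    rw [← Finset.mul_prod_erase _ _ hi]
    have h1' := (hp i).one_lt
    have h2' := blockProd_pos p hp (Sᶜ.erase i)
    nlinarith

include hp in
/-- An odd block `d_S` of `n = 2p₁⋯p_k` with `d_S ≡ 5 (mod 8)` is NOT in `R(n)` (`n/d_S = 2d_{Sᶜ} ≡ 6 (mod 8)`).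
[cite: TianYuanZhang2017, §3.1 (p0011 L67–L73)] -/
theorem blockProd_not_mem_recursionIndex_of_five (hn : n = 2 * ∏ i, p i) (h3 : (∏ i, p i) % 4 = 3) (S : Finset (Fin k))
    (h5 : (∏ i ∈ S, p i) % 8 = 5) : ∏ i ∈ S, p i ∉ recursionIndex n := by
  intro hmem
  obtain ⟨-, -, h123, -⟩ := mem_recursionIndex_iff.mp hmem
  have hdiv : n / ∏ i ∈ S, p i = 2 * ∏ i ∈ Sᶜ, p i := by
    rw [hn, ← Finset.prod_mul_prod_compl S p, show 2 * ((∏ i ∈ S, p i) * ∏ i ∈ Sᶜ, p i) = (∏ i ∈ S, p i) * (2 * ∏ i ∈ Sᶜ, p i) by ring]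
    exact Nat.mul_div_cancel_left _ (blockProd_pos p hp S)
  have hsplit : (∏ j ∈ S, p j) * (∏ j ∈ Sᶜ, p j) = ∏ i, p i := Finset.prod_mul_prod_compl S p
  have hmod := Nat.mul_mod (∏ j ∈ S, p j) (∏ j ∈ Sᶜ, p j) 4
  rw [hsplit, h3, show (∏ j ∈ S, p j) % 4 = 1 by omega, one_mul, Nat.mod_mod] at hmod
  rw [hdiv] at h123
  omega

/-! ## §2 The block indicators `ι` as forms in the bits -/

include hp hodd hinj in
/-- **`ι(2d_S)` as a form**: for `d_S ≡ 3 (mod 4)` and any `g`,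
`[2d_S ≡ 5,6 ∧ g fixes √−2d_S ∧ χ_{2d_S}(g)] = (1 + x_im + x_2 + Σ_t x_{q_t})·(Σ_t κ^S_t x_{q_t} + κ^S_∞ x_2)` over `𝔽₂` (`q = blockPrimes p S`).
[cite: TianYuanZhang2017, §3.1, Prop. 3.2 (2), Thm. 3.6 (2), proof of Lemma 3.21] -/
theorem iota_six_eq_form (hn : n = 2 * ∏ i, p i) (S : Finset (Fin k)) (hS : (∏ i ∈ S, p i) % 4 = 3)
    {zf : ℕ → APoint D.H} {Φf : ℕ → Finset (D.H ≃ₐ[ℚ] D.H)} {ΓHf ΓH'f : ℕ → Subgroup (D.H ≃ₐ[ℚ] D.H)}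
    {σf θf : ℕ → (D.H ≃ₐ[ℚ] D.H)} {cf : D.H ≃ₐ[ℚ] D.H}
    {ρ₂ : (d : ℕ) → (D.galK d →* RingClassGroup (GenusField d) 2)}
    {ρ₄ : (d : ℕ) → (D.galK d →* RingClassGroup (GenusField d) 4)}
    (hb : ∀ d ∈ n.divisors,
      ((d % 8 = 5 ∨ d % 8 = 6) → D.CMBlockSpec d (zf d) (Φf d) (ΓHf d) (ΓH'f d) (σf d) cf) ∧
      (d % 8 = 6 → D.ThetaBlockSpec d (zf d) (ΓHf d) (ΓH'f d) (σf d) (θf d)) ∧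
      (d % 8 = 7 → D.SevenBlockSpec d) ∧
      (d % 8 = 5 → D.RingClassTwoBlockSpec d (ΓHf d) (ΓH'f d) (ρ₂ d)) ∧
      (d % 8 = 6 → D.RingClassFourBlockSpec d (ΓHf d) (ΓH'f d) (ρ₄ d)) ∧
      (d % 8 = 5 → D.FrobeniusTwoBlockSpec d (ΓH'f d)) ∧
      (d % 8 = 6 → D.FrobeniusFourBlockSpec d (ΓH'f d)) ∧
      (d % 8 = 6 → D.FrobeniusFourValueBlockSpec d (ΓH'f d) (ρ₄ d)))
    (g : D.H ≃ₐ[ℚ] D.H) :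
    ((if ((2 * ∏ i ∈ S, p i) % 8 = 5 ∨ (2 * ∏ i ∈ S, p i) % 8 = 6) ∧
        g (D.sqrtNeg (2 * ∏ i ∈ S, p i)) = D.sqrtNeg (2 * ∏ i ∈ S, p i) ∧
        (g * g) ^ gK (2 * ∏ i ∈ S, p i) * (σf (2 * ∏ i ∈ S, p i))⁻¹ ∈ ΓH'f (2 * ∏ i ∈ S, p i) then 1 else 0 : ℕ) : ZMod 2) =
      (1 + (if g D.im = D.im then (0 : ZMod 2) else 1) + (if g (D.im * D.sqrtNeg 2) = D.im * D.sqrtNeg 2 then (0 : ZMod 2) else 1) +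
          ∑ t : Fin S.card, (if g (D.im * D.sqrtNeg (blockPrimes p S t)) = D.im * D.sqrtNeg (blockPrimes p S t) then (0 : ZMod 2) else 1)) *
        ((∑ t : Fin S.card,
          kerSum (Matrix.fromBlocks (legendreMatrix (blockPrimes p S) + legendreDiagonal (blockPrimes p S) (-2))
              (Matrix.of fun j (_ : Unit) => addLegendreSym 2 (blockPrimes p S j))
              (0 : Matrix Unit (Fin S.card) (ZMod 2)) (0 : Matrix Unit Unit (ZMod 2))) (Sum.inl t) *
            (if g (D.im * D.sqrtNeg (blockPrimes p S t)) = D.im * D.sqrtNeg (blockPrimes p S t) then (0 : ZMod 2) else 1)) +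
        kerSum (Matrix.fromBlocks (legendreMatrix (blockPrimes p S) + legendreDiagonal (blockPrimes p S) (-2))
              (Matrix.of fun j (_ : Unit) => addLegendreSym 2 (blockPrimes p S j))
              (0 : Matrix Unit (Fin S.card) (ZMod 2)) (0 : Matrix Unit Unit (ZMod 2))) (Sum.inr ()) *
          (if g (D.im * D.sqrtNeg 2) = D.im * D.sqrtNeg 2 then (0 : ZMod 2) else 1)) := by
  have h6 : (2 * ∏ i ∈ S, p i) % 8 = 6 := by omega
  have hbit := bit_sqrtNeg_two_mul_blockProd p hp D hn S g
  by_cases hfix : g (D.sqrtNeg (2 * ∏ i ∈ S, p i)) = D.sqrtNeg (2 * ∏ i ∈ S, p i)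
  · rw [if_pos hfix] at hbit
    rw [add_assoc (1 : ZMod 2), add_assoc (1 : ZMod 2), ← hbit, add_zero, one_mul,
      ← sqMotion_six_eq_sum_kerSum_mul_bits p hp hodd hinj D hn S hS hb g hfix]
    by_cases hχ : (g * g) ^ gK (2 * ∏ i ∈ S, p i) * (σf (2 * ∏ i ∈ S, p i))⁻¹ ∈ ΓH'f (2 * ∏ i ∈ S, p i)
    · rw [if_pos ⟨Or.inr h6, hfix, hχ⟩, if_pos hχ, Nat.cast_one]
    · rw [if_neg (fun hh => hχ hh.2.2), if_neg hχ, Nat.cast_zero]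
  · rw [if_neg hfix] at hbit
    rw [if_neg (fun hh => hfix hh.2.1), Nat.cast_zero, add_assoc (1 : ZMod 2), add_assoc (1 : ZMod 2), ← hbit,
      show (1 : ZMod 2) + 1 = 0 by decide, zero_mul]

include hp hodd hinj in
/-- **`ι(d_T)` as a form**: for `d_T ≡ 5 (mod 8)` and any `g`,
`[d_T ≡ 5,6 ∧ g fixes √−d_T ∧ χ_{d_T}(g)] = (1 + x_im + Σ_t x_{q_t})·Σ_{i∈T} blockRho p T i · x_i` over `𝔽₂`.
[cite: TianYuanZhang2017, §3.1, Prop. 3.2 (1), Thm. 3.6 (1), proof of Lemma 3.21] -/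
theorem iota_five_eq_form (hn : n = 2 * ∏ i, p i) (T : Finset (Fin k)) (hT : (∏ i ∈ T, p i) % 8 = 5)
    {zf : ℕ → APoint D.H} {Φf : ℕ → Finset (D.H ≃ₐ[ℚ] D.H)} {ΓHf ΓH'f : ℕ → Subgroup (D.H ≃ₐ[ℚ] D.H)}
    {σf θf : ℕ → (D.H ≃ₐ[ℚ] D.H)} {cf : D.H ≃ₐ[ℚ] D.H}
    {ρ₂ : (d : ℕ) → (D.galK d →* RingClassGroup (GenusField d) 2)}
    {ρ₄ : (d : ℕ) → (D.galK d →* RingClassGroup (GenusField d) 4)}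
    (hb : ∀ d ∈ n.divisors,
      ((d % 8 = 5 ∨ d % 8 = 6) → D.CMBlockSpec d (zf d) (Φf d) (ΓHf d) (ΓH'f d) (σf d) cf) ∧
      (d % 8 = 6 → D.ThetaBlockSpec d (zf d) (ΓHf d) (ΓH'f d) (σf d) (θf d)) ∧
      (d % 8 = 7 → D.SevenBlockSpec d) ∧
      (d % 8 = 5 → D.RingClassTwoBlockSpec d (ΓHf d) (ΓH'f d) (ρ₂ d)) ∧
      (d % 8 = 6 → D.RingClassFourBlockSpec d (ΓHf d) (ΓH'f d) (ρ₄ d)) ∧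
      (d % 8 = 5 → D.FrobeniusTwoBlockSpec d (ΓH'f d)) ∧
      (d % 8 = 6 → D.FrobeniusFourBlockSpec d (ΓH'f d)) ∧
      (d % 8 = 6 → D.FrobeniusFourValueBlockSpec d (ΓH'f d) (ρ₄ d)))
    (g : D.H ≃ₐ[ℚ] D.H) :
    ((if ((∏ i ∈ T, p i) % 8 = 5 ∨ (∏ i ∈ T, p i) % 8 = 6) ∧
        g (D.sqrtNeg (∏ i ∈ T, p i)) = D.sqrtNeg (∏ i ∈ T, p i) ∧
        (g * g) ^ gK (∏ i ∈ T, p i) * (σf (∏ i ∈ T, p i))⁻¹ ∈ ΓH'f (∏ i ∈ T, p i) then 1 else 0 : ℕ) : ZMod 2) =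
      (1 + (if g D.im = D.im then (0 : ZMod 2) else 1) +
          ∑ t : Fin T.card, (if g (D.im * D.sqrtNeg (blockPrimes p T t)) = D.im * D.sqrtNeg (blockPrimes p T t) then (0 : ZMod 2) else 1)) *
        ∑ i ∈ T, blockRho p T i * (if g (D.im * D.sqrtNeg (p i)) = D.im * D.sqrtNeg (p i) then (0 : ZMod 2) else 1) := by
  have hd : (∏ i ∈ T, p i) ∈ n.divisors := by
    rw [hn]
    exact Nat.mem_divisors.mpr ⟨Dvd.dvd.mul_left (Finset.prod_dvd_prod_of_subset _ _ _ (subset_univ T)) 2,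
      mul_ne_zero two_ne_zero (Finset.prod_ne_zero_iff.mpr fun i _ => (hp i).ne_zero)⟩
  obtain ⟨hCM, -, -, hRC2, -, hF2, -, -⟩ := hb _ hd
  have hbit := bit_sqrtNeg_blockProd p hp D hn T g
  by_cases hfix : g (D.sqrtNeg (∏ i ∈ T, p i)) = D.sqrtNeg (∏ i ∈ T, p i)
  · rw [if_pos hfix] at hbit
    rw [add_assoc (1 : ZMod 2), ← hbit, add_zero, one_mul,
      ← sqMotion_five_eq_sum_blockRho_mul_bits_even p hp hodd hinj D hn T hT (hCM (Or.inl hT)) (hRC2 hT) (hF2 hT) g hfix]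
    by_cases hχ : (g * g) ^ gK (∏ i ∈ T, p i) * (σf (∏ i ∈ T, p i))⁻¹ ∈ ΓH'f (∏ i ∈ T, p i)
    · rw [if_pos ⟨Or.inl hT, hfix, hχ⟩, if_pos hχ, Nat.cast_one]
    · rw [if_neg (fun hh => hχ hh.2.2), if_neg hχ, Nat.cast_zero]
  · rw [if_neg hfix] at hbit
    rw [if_neg (fun hh => hfix hh.2.1), Nat.cast_zero, add_assoc (1 : ZMod 2), ← hbit, show (1 : ZMod 2) + 1 = 0 by decide, zero_mul]

/-- `Σ_{d ∈ R(m)} f(d) = Σ_{d ∣ m} [d ∈ R(m)]·f(d)`. [folklore] -/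
theorem sum_recursionIndex_eq_sum_ite (m : ℕ) {M : Type*} [AddCommMonoid M] (f : ℕ → M) :
    ∑ d ∈ recursionIndex m, f d = ∑ d ∈ m.divisors, if d ∈ recursionIndex m then f d else 0 := by
  have hsub : recursionIndex m ⊆ m.divisors := fun d hd => (Finset.mem_filter.mp hd).1
  rw [Finset.sum_ite_mem, Finset.inter_eq_right.mpr hsub]

/-! ## §3 Level one with the top block -/

include hp hodd hinj in
/-- **Level 1 + top block as a form.**  For `n = 2p₁⋯p_k`, `∏pᵢ ≡ 3 (mod 4)`, the block clauses and Thm 1.1: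
`ι(n) + Σ_{d ∈ R(n)} |𝓛(n/d)|·ι(d) ≡ Σ_{S : d_{Sᶜ} ≡ 1 (8)} coblockWeight p S · (1 + x_im + x_2 + Σ_{t} x_{q_t}) · (Σ_t κ^S_t x_{q_t} + κ^S_∞ x_2) (mod 2)`
(the odd members of `R(n)` carry no `ι`; the even members are the `2d_S` with `d_{Sᶜ} ≡ 1 (8)`, `S ≠ univ`; the top block is `S = univ`).
[cite: TianYuanZhang2017, Thm. 1.1, §3.1 (p0011 L67–L73), Thm. 3.6 (2), proof of Lemma 3.21] [cite: HeathBrown1994SelmerCongruentII, Appendix (Monsky)] -/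
theorem levelOne_eq_sum_blocks (hn : n = 2 * ∏ i, p i) (h3 : (∏ i, p i) % 4 = 3) (hLs : D.scriptLSpec) (h11 : thm11_parity_of_scriptL)
    {zf : ℕ → APoint D.H} {Φf : ℕ → Finset (D.H ≃ₐ[ℚ] D.H)} {ΓHf ΓH'f : ℕ → Subgroup (D.H ≃ₐ[ℚ] D.H)}
    {σf θf : ℕ → (D.H ≃ₐ[ℚ] D.H)} {cf : D.H ≃ₐ[ℚ] D.H}
    {ρ₂ : (d : ℕ) → (D.galK d →* RingClassGroup (GenusField d) 2)}
    {ρ₄ : (d : ℕ) → (D.galK d →* RingClassGroup (GenusField d) 4)}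
    (hb : ∀ d ∈ n.divisors,
      ((d % 8 = 5 ∨ d % 8 = 6) → D.CMBlockSpec d (zf d) (Φf d) (ΓHf d) (ΓH'f d) (σf d) cf) ∧
      (d % 8 = 6 → D.ThetaBlockSpec d (zf d) (ΓHf d) (ΓH'f d) (σf d) (θf d)) ∧
      (d % 8 = 7 → D.SevenBlockSpec d) ∧
      (d % 8 = 5 → D.RingClassTwoBlockSpec d (ΓHf d) (ΓH'f d) (ρ₂ d)) ∧
      (d % 8 = 6 → D.RingClassFourBlockSpec d (ΓHf d) (ΓH'f d) (ρ₄ d)) ∧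
      (d % 8 = 5 → D.FrobeniusTwoBlockSpec d (ΓH'f d)) ∧
      (d % 8 = 6 → D.FrobeniusFourBlockSpec d (ΓH'f d)) ∧
      (d % 8 = 6 → D.FrobeniusFourValueBlockSpec d (ΓH'f d) (ρ₄ d)))
    (g : D.H ≃ₐ[ℚ] D.H) :
    (((if (n % 8 = 5 ∨ n % 8 = 6) ∧ g (D.sqrtNeg n) = D.sqrtNeg n ∧ (g * g) ^ gK n * (σf n)⁻¹ ∈ ΓH'f n then 1 else 0) +
        ∑ d ∈ recursionIndex n, (D.scriptL (n / d)).natAbs *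
          (if (d % 8 = 5 ∨ d % 8 = 6) ∧ g (D.sqrtNeg d) = D.sqrtNeg d ∧ (g * g) ^ gK d * (σf d)⁻¹ ∈ ΓH'f d then 1 else 0) : ℕ) :
        ZMod 2) =
      ∑ S : Finset (Fin k), if (∏ i ∈ Sᶜ, p i) % 8 = 1 then
        coblockWeight p S *
          ((1 + (if g D.im = D.im then (0 : ZMod 2) else 1) + (if g (D.im * D.sqrtNeg 2) = D.im * D.sqrtNeg 2 then (0 : ZMod 2) else 1) +
              ∑ t : Fin S.card,
                (if g (D.im * D.sqrtNeg (blockPrimes p S t)) = D.im * D.sqrtNeg (blockPrimes p S t) then (0 : ZMod 2) else 1)) *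
            ((∑ t : Fin S.card,
              kerSum (Matrix.fromBlocks (legendreMatrix (blockPrimes p S) + legendreDiagonal (blockPrimes p S) (-2))
                  (Matrix.of fun j (_ : Unit) => addLegendreSym 2 (blockPrimes p S j))
                  (0 : Matrix Unit (Fin S.card) (ZMod 2)) (0 : Matrix Unit Unit (ZMod 2))) (Sum.inl t) *
                (if g (D.im * D.sqrtNeg (blockPrimes p S t)) = D.im * D.sqrtNeg (blockPrimes p S t) then (0 : ZMod 2) else 1)) +
              kerSum (Matrix.fromBlocks (legendreMatrix (blockPrimes p S) + legendreDiagonal (blockPrimes p S) (-2))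
                  (Matrix.of fun j (_ : Unit) => addLegendreSym 2 (blockPrimes p S j))
                  (0 : Matrix Unit (Fin S.card) (ZMod 2)) (0 : Matrix Unit Unit (ZMod 2))) (Sum.inr ()) *
                (if g (D.im * D.sqrtNeg 2) = D.im * D.sqrtNeg 2 then (0 : ZMod 2) else 1)))
      else 0 := by
  subst hn
  -- abbreviations
  set ι : ℕ → ℕ := fun d =>
    if (d % 8 = 5 ∨ d % 8 = 6) ∧ g (D.sqrtNeg d) = D.sqrtNeg d ∧ (g * g) ^ gK d * (σf d)⁻¹ ∈ ΓH'f d then 1 else 0 with hι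
  set Ψ : Finset (Fin k) → ZMod 2 := fun S =>
    ((1 + (if g D.im = D.im then (0 : ZMod 2) else 1) + (if g (D.im * D.sqrtNeg 2) = D.im * D.sqrtNeg 2 then (0 : ZMod 2) else 1) +
        ∑ t : Fin S.card,
          (if g (D.im * D.sqrtNeg (blockPrimes p S t)) = D.im * D.sqrtNeg (blockPrimes p S t) then (0 : ZMod 2) else 1)) *
      ((∑ t : Fin S.card,
        kerSum (Matrix.fromBlocks (legendreMatrix (blockPrimes p S) + legendreDiagonal (blockPrimes p S) (-2))
            (Matrix.of fun j (_ : Unit) => addLegendreSym 2 (blockPrimes p S j))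
            (0 : Matrix Unit (Fin S.card) (ZMod 2)) (0 : Matrix Unit Unit (ZMod 2))) (Sum.inl t) *
          (if g (D.im * D.sqrtNeg (blockPrimes p S t)) = D.im * D.sqrtNeg (blockPrimes p S t) then (0 : ZMod 2) else 1)) +
        kerSum (Matrix.fromBlocks (legendreMatrix (blockPrimes p S) + legendreDiagonal (blockPrimes p S) (-2))
            (Matrix.of fun j (_ : Unit) => addLegendreSym 2 (blockPrimes p S j))
            (0 : Matrix Unit (Fin S.card) (ZMod 2)) (0 : Matrix Unit Unit (ZMod 2))) (Sum.inr ()) *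
          (if g (D.im * D.sqrtNeg 2) = D.im * D.sqrtNeg 2 then (0 : ZMod 2) else 1))) with hΨ
  -- the block indicator of an even block is the form `Ψ S`
  have hιS : ∀ S : Finset (Fin k), (∏ i ∈ S, p i) % 4 = 3 → ((ι (2 * ∏ i ∈ S, p i) : ℕ) : ZMod 2) = Ψ S := fun S hS =>
    iota_six_eq_form p hp hodd hinj D rfl S hS hb g
  -- Step 1: the recursion sum over divisors, split into odd and even sub-products
  have hsum : ((∑ d ∈ recursionIndex (2 * ∏ i, p i), (D.scriptL ((2 * ∏ i, p i) / d)).natAbs * ι d : ℕ) : ZMod 2) =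
      ∑ S : Finset (Fin k), if (∏ i ∈ Sᶜ, p i) % 8 = 1 ∧ S ≠ univ then coblockWeight p S * Ψ S else 0 := by
    rw [sum_recursionIndex_eq_sum_ite, sum_divisors_two_mul p hp hodd hinj rfl, Nat.cast_add, Nat.cast_sum, Nat.cast_sum]
    -- odd sub-products contribute nothing
    have hodd0 : (∑ S : Finset (Fin k), ((if (∏ i ∈ S, p i) ∈ recursionIndex (2 * ∏ i, p i) then
        (D.scriptL ((2 * ∏ i, p i) / ∏ i ∈ S, p i)).natAbs * ι (∏ i ∈ S, p i) else 0 : ℕ) : ZMod 2)) = 0 := by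
      refine Finset.sum_eq_zero fun S _ => ?_
      by_cases hmem : (∏ i ∈ S, p i) ∈ recursionIndex (2 * ∏ i, p i)
      · rw [if_pos hmem]
        have hoddS : Odd (∏ i ∈ S, p i) := by
          rw [← prod_blockPrimes p S]; exact odd_prod _ (blockPrimes_prime p hp S) (ne_two_of_odd _ (blockPrimes_odd p hodd S))
        have hι0 : ι (∏ i ∈ S, p i) = 0 := by
          simp only [hι]
          rw [if_neg]
          rintro ⟨h56, -, -⟩
          rcases h56 with h5 | h6
          · exact blockProd_not_mem_recursionIndex_of_five p hp rfl h3 S h5 hmem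
          · rcases hoddS with ⟨r, hr⟩; omega
        rw [hι0, mul_zero, Nat.cast_zero]
      · rw [if_neg hmem, Nat.cast_zero]
    rw [hodd0, zero_add]
    refine Finset.sum_congr rfl fun S _ => ?_
    by_cases hmem : 2 * ∏ i ∈ S, p i ∈ recursionIndex (2 * ∏ i, p i)
    · have hc := (two_mul_blockProd_mem_recursionIndex_iff p hp hodd rfl h3 S).mp hmem
      rw [if_pos hmem, if_pos hc, Nat.cast_mul, scriptL_parity_eq_coblockWeight_six p hp hodd hinj D h11 rfl hLs S hc.2 hc.1,
        hιS S (blockProd_mod_four_of_compl_one p h3 S hc.1)]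
    · have hc : ¬ ((∏ i ∈ Sᶜ, p i) % 8 = 1 ∧ S ≠ univ) := fun h =>
        hmem ((two_mul_blockProd_mem_recursionIndex_iff p hp hodd rfl h3 S).mpr h)
      rw [if_neg hmem, if_neg hc, Nat.cast_zero]
  -- Step 2: the top block is the `S = univ` term
  have htop : ((ι (2 * ∏ i, p i) : ℕ) : ZMod 2) = coblockWeight p univ * Ψ univ := by
    rw [coblockWeight_univ, one_mul]; exact hιS univ h3
  have hcast : (((if ((2 * ∏ i, p i) % 8 = 5 ∨ (2 * ∏ i, p i) % 8 = 6) ∧ g (D.sqrtNeg (2 * ∏ i, p i)) = D.sqrtNeg (2 * ∏ i, p i) ∧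
        (g * g) ^ gK (2 * ∏ i, p i) * (σf (2 * ∏ i, p i))⁻¹ ∈ ΓH'f (2 * ∏ i, p i) then 1 else 0) +
        ∑ d ∈ recursionIndex (2 * ∏ i, p i), (D.scriptL ((2 * ∏ i, p i) / d)).natAbs *
          (if (d % 8 = 5 ∨ d % 8 = 6) ∧ g (D.sqrtNeg d) = D.sqrtNeg d ∧ (g * g) ^ gK d * (σf d)⁻¹ ∈ ΓH'f d then 1 else 0) : ℕ) :
        ZMod 2) = ((ι (2 * ∏ i, p i) : ℕ) : ZMod 2) + ((∑ d ∈ recursionIndex (2 * ∏ i, p i),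
          (D.scriptL ((2 * ∏ i, p i) / d)).natAbs * ι d : ℕ) : ZMod 2) := by
    rw [← Nat.cast_add]
  rw [hcast, htop, hsum, Fintype.sum_eq_add_sum_compl (univ : Finset (Fin k)), Fintype.sum_eq_add_sum_compl (univ : Finset (Fin k))]
  rw [if_neg (fun h => h.2 rfl), zero_add, if_pos (by simp)]
  congr 1
  refine Finset.sum_congr rfl fun S hS => ?_
  have hne : S ≠ univ := by rw [Finset.mem_compl, Finset.mem_singleton] at hS; exact hS
  by_cases hc : (∏ i ∈ Sᶜ, p i) % 8 = 1
  · rw [if_pos ⟨hc, hne⟩, if_pos hc]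
  · rw [if_neg (fun h => hc h.1), if_neg hc]

end Summit.BirchSwinnertonDyer.PrintCf2.MoverAssembly

end
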